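import Summits.HubbardSuperconductivity.HubbardSuperconductivity.Theorems.ChiralWindowCwChannelInfContinuous
import Summits.HubbardSuperconductivity.HubbardSuperconductivity.Theorems.ChiralWindowCwThesisReductions
import Summits.HubbardSuperconductivity.HubbardSuperconductivity.Theorems.ChiralWindowCwThesisSignDecoupling
import Summits.HubbardSuperconductivity.HubbardSuperconductivity.Theorems.ChiralWindowCwThesisModulatedChannelState
import Summits.HubbardSuperconductivity.HubbardSuperconductivity.Theorems.ChiralWindowCwThesisQuarticInvariant
import Summits.HubbardSuperconductivity.HubbardSuperconductivity.Theorems.ChiralWindowCwThesisVanishingNearDiagonal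
import HarnessLib

/-!
# Route `ChiralWindow`, crux `CwThesis` (stmt-HubbardSuperconductivity-10438), line `SketchIdeator3` v5:
# the channel bottoms of the Kohn–Luttinger form are non-positive, and the anchor of the penalty line

Write `ε = squareDispersion 1 0`, `μ ∈ (-4, 0)` a level of the square-lattice band, `Γ_U(k,k') = U + U² χ₀(k+k')` the
Kohn–Luttinger pairing kernel on the Fermi curve and `channelInf ε μ U χ = sInf {⟨ψ, Γ_U ψ⟩ : ψ a normalised gap function of
the irrep χ}` (`KohnLuttinger.lean`). Main results:

* `stub_channelInfNonpos` (registered stub of the lead skeleton `Cruxes/CwThesis/Lines/SketchIdeator3.lean`, v5) —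
  **`channelInf ε μ U χ ≤ 0` for every `U`, every channel `χ` and every `μ ∈ (-4,0)`.** Riemann–Lebesgue mechanism without
  Fourier analysis: modulate one channel state `ψ₀` (`nonempty_isChannelState`) by the `D₄`-invariant sign patterns
  `m_s(k) = ±1` constant on the cells of the quartic invariant `q(k) = (k₀⁴-6k₀²k₁²+k₁⁴)/|k|⁴` (`= cos 4θ` along the polar
  parametrisation `fermiPolar μ θ`; `stub_quarticInvariant`), which keeps `IsChannelState` (`stub_modulatedChannelState`);
  in the polar picture (`pairingForm_eq_polar`, `integral_mul_integral_mul_eq_integral_prod`; the weighted kernel is in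
  `L²(dθdθ')` by `memLp_klKernelPolar` fed with `exists_torusSublevel_le`, `exists_shellVolume_le`) the sum of the pairing
  forms over the `2^J` patterns decouples the cells (`stub_signDecoupling`) and is bounded by `2^J ∫∫_{|cos4θ-cos4θ'|<1/(n+1)} |F|`,
  `F = M · Ψ₀ ⊗ Ψ₀ ∈ L¹`, which is `< 2^J e` for large `n` (`stub_vanishingNearDiagonal`); the minimum is below the average,
  so some channel state has pairing form `≤ e`, for every `e > 0`.
* `rlProviso` — the proviso of `cwThesis_of_klCanonical_of_cwKLChiralWindow` in its exact form (window dopings have their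
  chemical potential in the band, `chemicalPotentialOfDensity_window_mem_Ioo`).
* `cwThesis_of_klCanonical_of_cwKLChiralWindow'` — **the anchor, unconditional in its analytic proviso**:
  `TorusCooperLog.KLCanonical → ChiralWindow.CwKLChiralWindow → ChiralWindow.CwThesis` (stmt-2681 ∧ stmt-1741 ⇒ stmt-10438).
* `cwThesis_of_klCanonical_of_leading` — the same from `KLCanonical` and a LEADING-ONLY Kohn–Luttinger datum at one window
  doping (attractivity `Λ_{B1g} ≤ -γU²` is automatic from leading by `γU²` and `Λ_{A2g} ≤ 0`).

No definitions. References: W. Kohn, J. M. Luttinger, Phys. Rev. Lett. 15 (1965) 524; S. Raghu, S. A. Kivelson,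
D. J. Scalapino, Phys. Rev. B 81 (2010) 224505 §II (7), (13).
-/

noncomputable section

-- the tree's namespace repeats the summit name by design (D-0017)
set_option linter.dupNamespace false

namespace Summit.HubbardSuperconductivity.HubbardSuperconductivity.Theorems.CwThesis

open MeasureTheory Real Set Filter Topology
open Literature.MathematicalPhysics.QuantumLattice
open Summit.HubbardSuperconductivity.HubbardSuperconductivity.Theses

/-! ### The composition -/

/-- **Cells of `[-1,1]`**: two reals of `[-1, 1]` with the same index `min ⌊(x+1)(n+1)⌋₊ (2n+2)` are within
`1/(n+1)` of each other. [folklore] -/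
theorem abs_sub_lt_of_cell_eq (n : ℕ) {x x' : ℝ} (hx : -1 ≤ x) (hx1 : x ≤ 1) (hx' : -1 ≤ x') (hx'1 : x' ≤ 1)
    (h : min ⌊(x + 1) * ((n : ℝ) + 1)⌋₊ (2 * n + 2) = min ⌊(x' + 1) * ((n : ℝ) + 1)⌋₊ (2 * n + 2)) :
    |x - x'| < 1 / ((n : ℝ) + 1) := by
  have hn : (0 : ℝ) < (n : ℝ) + 1 := by positivity
  have hy : 0 ≤ (x + 1) * ((n : ℝ) + 1) := mul_nonneg (by linarith) hn.le
  have hy' : 0 ≤ (x' + 1) * ((n : ℝ) + 1) := mul_nonneg (by linarith) hn.le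
  have hle : ∀ {y : ℝ}, y ≤ 1 → ⌊(y + 1) * ((n : ℝ) + 1)⌋₊ ≤ 2 * n + 2 := by
    intro y hy1
    have : (y + 1) * ((n : ℝ) + 1) ≤ ((2 * n + 2 : ℕ) : ℝ) := by push_cast; nlinarith
    exact (Nat.floor_mono this).trans (Nat.floor_natCast _).le
  rw [min_eq_left (hle hx1), min_eq_left (hle hx'1)] at h
  have h1 := Nat.floor_le hy
  have h2 := Nat.lt_floor_add_one ((x + 1) * ((n : ℝ) + 1))
  have h3 := Nat.floor_le hy'
  have h4 := Nat.lt_floor_add_one ((x' + 1) * ((n : ℝ) + 1))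
  rw [h] at h1 h2
  have hlt : |(x - x') * ((n : ℝ) + 1)| < 1 := by
    rw [abs_lt]; constructor <;> nlinarith
  rw [abs_mul, abs_of_pos hn] at hlt
  rw [lt_div_iff₀ hn]
  exact hlt

/-- **The channel bottom is non-positive on the band.** For `ε = squareDispersion 1 0`, `-4 < μ < 0`, every coupling
`U` and every symmetry channel `χ`: `channelInf ε μ U χ ≤ 0`. Riemann–Lebesgue mechanism: modulate one channel state
by `D₄`-invariant sign patterns on the cells of the quartic invariant (`= cos 4θ` along the Fermi curve), average the
pairing form over the `2^J` patterns (sign decoupling), and bound the average by the `L¹` mass of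
`Ψ₀ ⊗ Ψ₀ · M` near the diagonal `{cos 4θ = cos 4θ'}`, which vanishes as the cells shrink. [folklore] -/
theorem stub_channelInfNonpos (U : ℝ) (χ : D4Irrep) {μ : ℝ} (hμ : μ ∈ Set.Ioo (-4 : ℝ) 0) :
    channelInf (squareDispersion 1 0) μ U χ ≤ 0 := by
  obtain ⟨hμ₁, hμ₂⟩ := hμ
  unfold channelInf
  set S := pairingForm (squareDispersion 1 0) μ U '' {ψ | IsChannelState (squareDispersion 1 0) μ χ ψ} with hS
  by_cases hbdd : BddBelow S
  swap
  · rw [Real.sInf_of_not_bddBelow hbdd]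
  suffices key : ∀ e : ℝ, 0 < e → ∃ ψ, IsChannelState (squareDispersion 1 0) μ χ ψ ∧
      pairingForm (squareDispersion 1 0) μ U ψ ≤ e by
    refine le_of_forall_pos_le_add fun e he => ?_
    obtain ⟨ψ, hψ, hle⟩ := key e he
    rw [zero_add]
    exact (csInf_le hbdd ⟨ψ, hψ, rfl⟩).trans hle
  intro e he
  -- one channel state
  obtain ⟨ψ₀, hψ₀⟩ := nonempty_isChannelState hμ₁ hμ₂ χ
  -- (K1): the polar kernel is Hilbert–Schmidt
  obtain ⟨C, β, hC, hβ0, hβ2, hT⟩ := exists_torusSublevel_le hμ₁ hμ₂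
  obtain ⟨Csh, hCsh, hSV⟩ := exists_shellVolume_le hμ₁ hμ₂
  have hM : MemLp (fun z : ℝ × ℝ =>
      fermiPolarDOS μ (Prod.fst z) * kohnLuttingerKernel (squareDispersion 1 0) μ U (fermiPolar μ (Prod.fst z))
        (fermiPolar μ (Prod.snd z)) * fermiPolarDOS μ (Prod.snd z)) 2 ((volume.restrict (Set.Ioc (-π) π)).prod (volume.restrict (Set.Ioc (-π) π))) :=
    memLp_klKernelPolar hμ₁ hμ₂ U hC hβ0 hβ2 hCsh (hT μ ⟨le_rfl, le_rfl⟩) (hSV μ ⟨le_rfl, le_rfl⟩)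
  -- density of states bounded below
  obtain ⟨w₀, w₁, hw₀, hw⟩ := exists_bounds_fermiPolarDOS hμ₁ hμ₂
  have hwlow : ∀ θ, w₀ ≤ fermiPolarDOS μ θ := fun θ => (hw θ).1
  -- the profile of `ψ₀` is in `L²`
  have hΨ₀ : MemLp (fun θ => ψ₀ (fermiPolar μ θ)) 2 (volume.restrict (Set.Ioc (-π) π)) := (memLp_profile hμ₁ hμ₂ hψ₀.1 hw₀ hwlow).1
  -- the integrand `F = M · Ψ₀ ⊗ Ψ₀` is integrable
  set F : ℝ × ℝ → ℝ := fun z => (fun z : ℝ × ℝ =>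
      fermiPolarDOS μ (Prod.fst z) * kohnLuttingerKernel (squareDispersion 1 0) μ U (fermiPolar μ (Prod.fst z))
        (fermiPolar μ (Prod.snd z)) * fermiPolarDOS μ (Prod.snd z)) z * (ψ₀ (fermiPolar μ z.1) * ψ₀ (fermiPolar μ z.2)) with hFdef
  have hFint : Integrable F ((volume.restrict (Set.Ioc (-π) π)).prod (volume.restrict (Set.Ioc (-π) π))) := hM.integrable_mul (memLp_two_tensor hΨ₀)
  -- choose the cell size: small `L¹` mass near the diagonal
  have hlim := stub_vanishingNearDiagonal hFint
  obtain ⟨n, hn⟩ := (hlim.eventually (gt_mem_nhds he)).exists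
  set Sn : Set (ℝ × ℝ) := {z : ℝ × ℝ | |Real.cos (4 * z.1) - Real.cos (4 * z.2)| < 1 / ((n : ℝ) + 1)} with hSn
  have hSn_meas : MeasurableSet Sn :=
    measurableSet_lt (by fun_prop) (by fun_prop)
  -- the quartic invariant and the cells
  obtain ⟨hqinv, hqpolar, hqmeas⟩ := stub_quarticInvariant
  set q : Momentum → ℝ := fun k : Momentum =>
    (k 0 ^ 4 - 6 * k 0 ^ 2 * k 1 ^ 2 + k 1 ^ 4) / (k 0 ^ 2 + k 1 ^ 2) ^ 2 with hqdef
  set idxR : ℝ → Fin (2 * n + 3) := fun x =>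
    ⟨min ⌊(x + 1) * ((n : ℝ) + 1)⌋₊ (2 * n + 2), (min_le_right _ _).trans_lt (by omega)⟩ with hidxR
  have hidx : Measurable idxR := by
    show Measurable ((fun a : ℕ => (⟨min a (2 * n + 2), (min_le_right _ _).trans_lt (by omega)⟩ : Fin (2 * n + 3))) ∘
      fun x : ℝ => ⌊(x + 1) * ((n : ℝ) + 1)⌋₊)
    exact measurable_from_nat.comp (Nat.measurable_floor.comp (by fun_prop))
  -- the sign patterns
  set m : (Fin (2 * n + 3) → Bool) → Momentum → ℝ := fun s k => if s (idxR (q k)) then (1:ℝ) else -1 with hmdef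
  have hmeas : ∀ s, Measurable (m s) := fun s => by
    show Measurable ((fun i : Fin (2 * n + 3) => if s i then (1:ℝ) else -1) ∘ fun k => idxR (q k))
    exact (measurable_of_countable _).comp (hidx.comp hqmeas)
  have habs : ∀ s k, |m s k| = 1 := fun s k => by
    simp only [hmdef]; split_ifs <;> simp
  have hsq : ∀ s k, m s k ^ 2 = 1 := fun s k => by
    rw [← sq_abs, habs, one_pow]
  have hinv : ∀ s (g : DihedralGroup 4) (k : Momentum), m s (d4Momentum g k) = m s k := fun s g k => by
    simp only [hmdef]; rw [hqinv g k]
  -- modulated channel states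
  have hms : ∀ s, IsChannelState (squareDispersion 1 0) μ χ (fun k => m s k * ψ₀ k) := fun s =>
    stub_modulatedChannelState hψ₀ (hmeas s) (hsq s) (hinv s)
  -- their pairing forms as product integrals
  have hform : ∀ s, pairingForm (squareDispersion 1 0) μ U (fun k => m s k * ψ₀ k) =
      ∫ z, (m s (fermiPolar μ z.1) * m s (fermiPolar μ z.2)) * F z ∂((volume.restrict (Set.Ioc (-π) π)).prod (volume.restrict (Set.Ioc (-π) π))) := by
    intro s
    have hΨs : MemLp (fun θ => m s (fermiPolar μ θ) * ψ₀ (fermiPolar μ θ)) 2 (volume.restrict (Set.Ioc (-π) π)) :=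
      (memLp_profile hμ₁ hμ₂ (hms s).1 hw₀ hwlow).1
    rw [pairingForm_eq_polar hμ₁ hμ₂ U (hms s).1.1]
    have h := integral_mul_integral_mul_eq_integral_prod hΨs hM
    refine h.trans ?_
    refine integral_congr_ae (Eventually.of_forall fun z => ?_)
    simp only [hFdef]
    ring
  -- integrability of each modulated integrand
  have hint_s : ∀ s, Integrable (fun z : ℝ × ℝ => (m s (fermiPolar μ z.1) * m s (fermiPolar μ z.2)) * F z)
      ((volume.restrict (Set.Ioc (-π) π)).prod (volume.restrict (Set.Ioc (-π) π))) := by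
    intro s
    refine hFint.bdd_mul (c := 1) ?_ (Eventually.of_forall fun z => ?_)
    · exact (((hmeas s).comp ((continuous_fermiPolar hμ₁ hμ₂).measurable.comp measurable_fst)).mul
        ((hmeas s).comp ((continuous_fermiPolar hμ₁ hμ₂).measurable.comp measurable_snd))).aestronglyMeasurable
    · rw [Real.norm_eq_abs, abs_mul, habs, habs, one_mul]
  -- sign decoupling, pointwise
  have hfac : ∀ z : ℝ × ℝ, ∑ s : Fin (2 * n + 3) → Bool, m s (fermiPolar μ z.1) * m s (fermiPolar μ z.2) =
      if idxR (q (fermiPolar μ z.1)) = idxR (q (fermiPolar μ z.2)) then (2:ℝ) ^ (2 * n + 3) else 0 := fun z =>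
    stub_signDecoupling (2 * n + 3) _ _
  -- same cell ⇒ near the diagonal
  have hcos : ∀ θ : ℝ, q (fermiPolar μ θ) = Real.cos (4 * θ) := fun θ => hqpolar μ ⟨hμ₁, hμ₂⟩ θ
  have hD_sub : ∀ z : ℝ × ℝ, idxR (q (fermiPolar μ z.1)) = idxR (q (fermiPolar μ z.2)) → z ∈ Sn := by
    intro z hz
    rw [hcos, hcos] at hz
    have hz' := congrArg Fin.val hz
    simp only [hidxR] at hz'
    exact abs_sub_lt_of_cell_eq n (Real.neg_one_le_cos _) (Real.cos_le_one _) (Real.neg_one_le_cos _)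
      (Real.cos_le_one _) hz'
  -- the sum of the pairing forms
  have hsum : ∑ s : Fin (2 * n + 3) → Bool, pairingForm (squareDispersion 1 0) μ U (fun k => m s k * ψ₀ k) =
      ∫ z, ∑ s : Fin (2 * n + 3) → Bool, (m s (fermiPolar μ z.1) * m s (fermiPolar μ z.2)) * F z
        ∂((volume.restrict (Set.Ioc (-π) π)).prod (volume.restrict (Set.Ioc (-π) π))) := by
    rw [integral_finsetSum _ (fun s _ => hint_s s)]
    exact Finset.sum_congr rfl (fun s _ => hform s)
  have hle : ∫ z, ∑ s : Fin (2 * n + 3) → Bool, (m s (fermiPolar μ z.1) * m s (fermiPolar μ z.2)) * F z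
        ∂((volume.restrict (Set.Ioc (-π) π)).prod (volume.restrict (Set.Ioc (-π) π))) ≤ (2:ℝ) ^ (2 * n + 3) * ∫ z in Sn, |F z| ∂((volume.restrict (Set.Ioc (-π) π)).prod (volume.restrict (Set.Ioc (-π) π))) := by
    rw [← integral_indicator hSn_meas, ← integral_const_mul]
    refine integral_mono (integrable_finsetSum _ (fun s _ => hint_s s))
      ((hFint.abs.indicator hSn_meas).const_mul _) fun z => ?_
    dsimp only
    rw [← Finset.sum_mul, hfac z]
    by_cases hD : idxR (q (fermiPolar μ z.1)) = idxR (q (fermiPolar μ z.2))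
    · rw [if_pos hD, Set.indicator_of_mem (hD_sub z hD)]
      exact mul_le_mul_of_nonneg_left (le_abs_self _) (by positivity)
    · rw [if_neg hD, zero_mul]
      exact mul_nonneg (by positivity) (Set.indicator_nonneg (fun _ _ => abs_nonneg _) _)
  -- average ⇒ some pattern is below `e`
  have havg : ∑ s : Fin (2 * n + 3) → Bool, pairingForm (squareDispersion 1 0) μ U (fun k => m s k * ψ₀ k) ≤
      ∑ _s : Fin (2 * n + 3) → Bool, e := by
    rw [Finset.sum_const, Finset.card_univ, Fintype.card_fun, Fintype.card_bool, Fintype.card_fin, nsmul_eq_mul]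
    push_cast
    calc ∑ s : Fin (2 * n + 3) → Bool, pairingForm (squareDispersion 1 0) μ U (fun k => m s k * ψ₀ k)
        = _ := hsum
      _ ≤ (2:ℝ) ^ (2 * n + 3) * ∫ z in Sn, |F z| ∂((volume.restrict (Set.Ioc (-π) π)).prod (volume.restrict (Set.Ioc (-π) π))) := hle
      _ ≤ (2:ℝ) ^ (2 * n + 3) * e := by gcongr
  obtain ⟨s, -, hs⟩ := Finset.exists_le_of_sum_le Finset.univ_nonempty havg
  exact ⟨_, hms s, hs⟩

/-! ### The proviso and the anchor -/

/-- **The Riemann–Lebesgue proviso of the anchor**, in the exact form consumed by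
`cwThesis_of_klCanonical_of_cwKLChiralWindow`: at every doping of the window `[3/10, 12/25]` and every `U > 0` some
non-`B₁g` channel bottom is `≤ 0` (indeed every channel bottom is; the window doping has its chemical potential in the band,
`chemicalPotentialOfDensity_window_mem_Ioo`). [folklore] -/
theorem rlProviso :
    ∀ δ ∈ Set.Icc (3/10 : ℝ) (12/25), ∀ U : ℝ, 0 < U → ∃ χ : D4Irrep, χ ≠ D4Irrep.B1g ∧
      channelInf (squareDispersion 1 0) (chemicalPotentialOfDensity (squareDispersion 1 0) (1 - δ)) U χ ≤ 0 := by
  intro δ hδ U _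
  refine ⟨D4Irrep.A2g, by decide, ?_⟩
  have hδ' : δ ∈ Set.Icc (1 / 4 : ℝ) (12 / 25) := ⟨by linarith [hδ.1], hδ.2⟩
  exact stub_channelInfNonpos U _ (chemicalPotentialOfDensity_window_mem_Ioo hδ')

/-- **The anchor of the penalty line, unconditional in its analytic proviso.** The sibling crux
`TorusCooperLog.KLCanonical` (stmt-HubbardSuperconductivity-2681) and the route's certified Kohn–Luttinger window datum
`ChiralWindow.CwKLChiralWindow` (stmt-HubbardSuperconductivity-1741) imply the crux `ChiralWindow.CwThesis`
(stmt-HubbardSuperconductivity-10438): `cwThesis_of_klCanonical_of_cwKLChiralWindow` with `rlProviso` discharged. [folklore] -/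
theorem cwThesis_of_klCanonical_of_cwKLChiralWindow' (hKL : TorusCooperLog.KLCanonical)
    (hW : ChiralWindow.CwKLChiralWindow) : ChiralWindow.CwThesis :=
  cwThesis_of_klCanonical_of_cwKLChiralWindow hKL hW rlProviso

/-- **The anchor from a leading-only datum.** `TorusCooperLog.KLCanonical` and a Kohn–Luttinger datum at ONE window doping
`δ₀ ∈ [3/10, 12/25]` asserting only that `B₁g` LEADS every other channel by `γU²` for all small `U` imply `ChiralWindow.CwThesis`:
attractivity `Λ_{B1g} ≤ -γU²` follows from leading and `Λ_{A2g} ≤ 0` (`stub_channelInfNonpos`), and `cwThesis_of_klCanonical`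
concludes. [folklore] -/
theorem cwThesis_of_klCanonical_of_leading (hKL : TorusCooperLog.KLCanonical)
    (hlead : ∃ δ₀ ∈ Set.Icc (3/10 : ℝ) (12/25), ∃ γ U₁ : ℝ, 0 < γ ∧ 0 < U₁ ∧ ∀ U ∈ Set.Ioo (0:ℝ) U₁,
      ∀ χ : D4Irrep, χ ≠ D4Irrep.B1g →
        channelInf (squareDispersion 1 0) (chemicalPotentialOfDensity (squareDispersion 1 0) (1 - δ₀)) U
            D4Irrep.B1g + γ * U ^ 2 ≤
          channelInf (squareDispersion 1 0) (chemicalPotentialOfDensity (squareDispersion 1 0) (1 - δ₀)) U χ) :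
    ChiralWindow.CwThesis := by
  obtain ⟨δ₀, hδ₀, γ, U₁, hγ, hU₁, h⟩ := hlead
  refine cwThesis_of_klCanonical hKL ⟨δ₀, hδ₀, γ, U₁, hγ, hU₁, fun U hU => ⟨?_, h U hU⟩⟩
  obtain ⟨χ, hχ, hχ0⟩ := rlProviso δ₀ hδ₀ U hU.1
  have hle := h U hU χ hχ
  linarith

/-- **Cross-route remark (`TorusCooperLog.CertB1g`, stmt-HubbardSuperconductivity-2682).** At a doping
`δ ∈ [1/4, 12/25]`, `δ < 1/2`, a LEADING-ONLY Kohn–Luttinger datum (B₁g below every other channel by `γU²` for all small `U`)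
already gives the sibling route's certified datum `CertB1g`, whose attractivity clause `Λ_{B1g} ≤ -γU²` is automatic by
`stub_channelInfNonpos` (`Λ_{A2g} ≤ 0`). [folklore] -/
theorem certB1g_of_leading {δ : ℝ} (hδ : δ ∈ Set.Icc (1 / 4 : ℝ) (12 / 25)) (hδ0 : 0 < δ) (hδ2 : δ < 1 / 2)
    (hlead : ∃ γ U₁ : ℝ, 0 < γ ∧ 0 < U₁ ∧ ∀ U ∈ Set.Ioo (0:ℝ) U₁, ∀ χ : D4Irrep, χ ≠ D4Irrep.B1g →
        channelInf (squareDispersion 1 0) (chemicalPotentialOfDensity (squareDispersion 1 0) (1 - δ)) U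
            D4Irrep.B1g + γ * U ^ 2 ≤
          channelInf (squareDispersion 1 0) (chemicalPotentialOfDensity (squareDispersion 1 0) (1 - δ)) U χ) :
    TorusCooperLog.CertB1g := by
  obtain ⟨γ, U₁, hγ, hU₁, h⟩ := hlead
  refine ⟨δ, ⟨hδ0, hδ2⟩, γ, U₁, hγ, hU₁, fun U hU => ⟨?_, h U hU⟩⟩
  have hA := stub_channelInfNonpos U D4Irrep.A2g (chemicalPotentialOfDensity_window_mem_Ioo hδ)
  have hle := h U hU D4Irrep.A2g (by decide)
  linarith

end Summit.HubbardSuperconductivity.HubbardSuperconductivity.Theorems.CwThesis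

end
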